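import Mathlib.Analysis.Calculus.ContDiff.Basic
import Mathlib.Analysis.Calculus.ContDiff.Operations
import Mathlib.Analysis.Calculus.FDeriv.Symmetric
import Mathlib.Analysis.Calculus.FDeriv.Prod
import Mathlib.Analysis.Calculus.FDeriv.Mul
import Mathlib.Analysis.InnerProductSpace.PiL2
import Mathlib.Algebra.BigOperators.Fin
import HarnessLib

/-!
# Coordinate jets of a path of functions on the plane (Cerf 1968, Ch. II §2, equations (6))

Topic `Literature/Topology/FourManifolds` (programme of the fact
`Literature.Topology.FourManifolds.cerf_pi0DiffDisc_relBoundary_three`, brick C1 = Cerf's genericity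
theorem for paths of functions, LNM 53 (1968), Ch. II).  J. Cerf, *Sur les difféomorphismes de
la sphère de dimension trois (Γ₄ = 0)*, Ch. II §2, "Premier temps", studies a differentiable
path `f : λ ↦ f_λ` in the space `𝒳 = C^∞(V, ℝ)` of functions on a compact surface `V` through the
map it defines on `V × I` and, in a chart `(x, y)` of `V`, through the coordinates (equations
(6), p. 13 of the book):

> `z = f(x, y, λ)`, `p = ∂f/∂x`, `q = ∂f/∂y`, `μ = ∂f/∂λ`, `r = ∂²f/∂x²`, `s = ∂²f/∂x∂y`,
> `t = ∂²f/∂y²`, …, and `δ = D(p, q)/D(x, y) = rt - s²`.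

This small DEFINITIONS file fixes these coordinates for a function `f : ℝ × ℝ² → ℝ` of
`(λ, (x, y))` (`ℝ² = EuclideanSpace ℝ (Fin 2)`, the model of the tree's surface charts), to be
used by the genericity theorems (`CerfExcellentPaths*.lean`):

* `CerfPath.dir i = (0, eᵢ)` — the coordinate directions of the surface factor;
* `CerfPath.d1 f z i` — the first partials `p, q` (`i = 0, 1`);
* `CerfPath.d2 f z i j` — the second partials `r, s, s, t`;
* `CerfPath.dt f z` — the `λ`-derivative `μ`;
* `CerfPath.jet2 f z = ![r, s, t]` — the three independent second partials;
* `CerfPath.hessDet f z = r t - s²` — Cerf's `δ` (the Hessian determinant of the slice for a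
  `C²` function, `hessDet_eq_det`);
* `CerfPath.lin c` — the linear map `ṗ ↦ ∑ᵢ ṗᵢ cᵢ : ℝᵐ → V`, through which the parameter
  derivatives of all jets of the perturbed family are expressed (`CerfPath.D0/D1/D2 w z`);
* `CerfPath.perturb g w p = g + ∑ᵢ pᵢ wᵢ` — a finite-dimensional family of perturbations of the
  path `g` (the finite-dimensional shadow of Thom's transversality set-up of Ch. II §1),

and proves their calculus: linearity in the perturbation parameter (`d1_perturb`, `d2_perturb`,
`dt_perturb`), smoothness (`contDiff_d1`, `contDiff_d2`, `contDiff_dt`, `contDiff_hessDet`, and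
joint smoothness in `(p, z)`), symmetry of the second partials (`d2_symm`), and the dictionary
with the derivatives of the slices `f_λ = f (λ, ·)` (`fderiv_slice_apply_single`,
`fderiv_fderiv_slice_apply_single`): `p, q` ARE the partials of `f_λ` and `r, s, t` its second
partials, so that "`(x, y)` is a critical point of `f_λ`" reads `d1 f (λ, (x, y)) = 0` and "the
Hessian of `f_λ` is degenerate there" reads `hessDet f (λ, (x, y)) = 0`.

Everything beyond the six definitions is proved; no named facts.

## References

* J. Cerf, *Sur les difféomorphismes de la sphère de dimension trois (Γ₄ = 0)*, Lecture Notes in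
  Math. 53, Springer (1968), Ch. II §2, equations (6)–(8), Définition 1. [CerfDiffeoSphere1968]
-/

noncomputable section

open Set Function Filter
open scoped ContDiff Topology BigOperators

namespace Literature.Topology.FourManifolds

namespace CerfPath

/-- Local notation for this file: the model plane `ℝ² = EuclideanSpace ℝ (Fin 2)`. -/
local notation "𝔼²" => EuclideanSpace ℝ (Fin 2)

/-! ### The six definitions -/

/-- The coordinate direction `(0, eᵢ)` of the surface factor of `ℝ × ℝ²` (`e₀ = ∂/∂x`,
`e₁ = ∂/∂y` in Cerf's notation). [cite: CerfDiffeoSphere1968, Ch. II §2, (6)] -/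
def dir (i : Fin 2) : ℝ × 𝔼² := (0, EuclideanSpace.single i 1)

/-- Cerf's first partials `p = ∂f/∂x` (`i = 0`), `q = ∂f/∂y` (`i = 1`) of `f(λ, x, y)` at
`z = (λ, (x, y))`. [cite: CerfDiffeoSphere1968, Ch. II §2, (6)] -/
def d1 (f : ℝ × 𝔼² → ℝ) (z : ℝ × 𝔼²) (i : Fin 2) : ℝ :=
  fderiv ℝ f z (dir i)

/-- Cerf's second partials `r = ∂²f/∂x²` (`i = j = 0`), `s = ∂²f/∂x∂y`, `t = ∂²f/∂y²`
(`i = j = 1`) of `f(λ, x, y)` at `z`. [cite: CerfDiffeoSphere1968, Ch. II §2, (6)] -/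
def d2 (f : ℝ × 𝔼² → ℝ) (z : ℝ × 𝔼²) (i j : Fin 2) : ℝ :=
  fderiv ℝ (fderiv ℝ f) z (dir i) (dir j)

/-- Cerf's `μ = ∂f/∂λ`, the derivative along the path parameter.
[cite: CerfDiffeoSphere1968, Ch. II §2, (6)] -/
def dt (f : ℝ × 𝔼² → ℝ) (z : ℝ × 𝔼²) : ℝ :=
  fderiv ℝ f z (1, 0)

/-- The three independent second partials `(r, s, t)` of `f(λ, x, y)` at `z`, as a vector of
`ℝ³`. [cite: CerfDiffeoSphere1968, Ch. II §2, (6)] -/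
def jet2 (f : ℝ × 𝔼² → ℝ) (z : ℝ × 𝔼²) : Fin 3 → ℝ :=
  ![d2 f z 0 0, d2 f z 0 1, d2 f z 1 1]

/-- Cerf's `δ = D(p, q)/D(x, y) = rt - s²`, the Hessian determinant of the slice `f_λ` at
`(x, y)` (for a `C²` function; `hessDet_eq_det`). [cite: CerfDiffeoSphere1968, Ch. II §2, after (8)] -/
def hessDet (f : ℝ × 𝔼² → ℝ) (z : ℝ × 𝔼²) : ℝ :=
  d2 f z 0 0 * d2 f z 1 1 - d2 f z 0 1 ^ 2

/-- The polynomial `Δ(r, s, t) = rt - s²` on `ℝ³`, so that `δ = Δ(r, s, t)` (`hessDet_eq_delta`).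
[cite: CerfDiffeoSphere1968, Ch. II §2, (7)] -/
def delta (h : Fin 3 → ℝ) : ℝ := h 0 * h 2 - h 1 ^ 2

/-- The finite-dimensional family of perturbed paths `g + ∑ᵢ pᵢ wᵢ`, `p ∈ ℝᵐ` (the
finite-dimensional probe through which Thom's transversality theorems of Cerf's Ch. II §1 are
applied to paths in Ch. II §2). [cite: CerfDiffeoSphere1968, Ch. II §1–2] -/
def perturb {ι : Type*} [Fintype ι] (g : ℝ × 𝔼² → ℝ) (w : ι → ℝ × 𝔼² → ℝ) (p : ι → ℝ) :
    ℝ × 𝔼² → ℝ :=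
  fun z => g z + ∑ i, p i * w i z

/-! ### Unfolding -/

/-- Unfolding of `dir`. [folklore] -/
theorem dir_apply (i : Fin 2) : dir i = ((0 : ℝ), EuclideanSpace.single i (1 : ℝ)) := rfl

/-- Unfolding of `d1`. [folklore] -/
theorem d1_def (f : ℝ × 𝔼² → ℝ) (z : ℝ × 𝔼²) (i : Fin 2) : d1 f z i = fderiv ℝ f z (dir i) := rfl

/-- Unfolding of `d2`. [folklore] -/
theorem d2_def (f : ℝ × 𝔼² → ℝ) (z : ℝ × 𝔼²) (i j : Fin 2) :
    d2 f z i j = fderiv ℝ (fderiv ℝ f) z (dir i) (dir j) := rfl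

/-- Unfolding of `dt`. [folklore] -/
theorem dt_def (f : ℝ × 𝔼² → ℝ) (z : ℝ × 𝔼²) : dt f z = fderiv ℝ f z (1, 0) := rfl

/-- Unfolding of `hessDet`. [folklore] -/
theorem hessDet_def (f : ℝ × 𝔼² → ℝ) (z : ℝ × 𝔼²) :
    hessDet f z = d2 f z 0 0 * d2 f z 1 1 - d2 f z 0 1 ^ 2 := rfl

/-- `jet2 f z 0 = r`. [folklore] -/
@[simp] theorem jet2_zero (f : ℝ × 𝔼² → ℝ) (z : ℝ × 𝔼²) : jet2 f z 0 = d2 f z 0 0 := rfl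
/-- `jet2 f z 1 = s`. [folklore] -/
@[simp] theorem jet2_one (f : ℝ × 𝔼² → ℝ) (z : ℝ × 𝔼²) : jet2 f z 1 = d2 f z 0 1 := rfl
/-- `jet2 f z 2 = t`. [folklore] -/
@[simp] theorem jet2_two (f : ℝ × 𝔼² → ℝ) (z : ℝ × 𝔼²) : jet2 f z 2 = d2 f z 1 1 := rfl

/-- Unfolding of `delta`. [folklore] -/
theorem delta_apply (h : Fin 3 → ℝ) : delta h = h 0 * h 2 - h 1 ^ 2 := rfl

/-- `δ = Δ(r, s, t)`. [cite: CerfDiffeoSphere1968, Ch. II §2, (7)] -/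
theorem hessDet_eq_delta (f : ℝ × 𝔼² → ℝ) (z : ℝ × 𝔼²) : hessDet f z = delta (jet2 f z) := rfl

/-- Unfolding of `perturb`. [folklore] -/
theorem perturb_apply {ι : Type*} [Fintype ι] (g : ℝ × 𝔼² → ℝ) (w : ι → ℝ × 𝔼² → ℝ) (p : ι → ℝ)
    (z : ℝ × 𝔼²) : perturb g w p z = g z + ∑ i, p i * w i z := rfl

/-- The unperturbed path: `perturb g w 0 = g`. [folklore] -/
theorem perturb_zero {ι : Type*} [Fintype ι] (g : ℝ × 𝔼² → ℝ) (w : ι → ℝ × 𝔼² → ℝ) :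
    perturb g w 0 = g := by
  funext z; simp [perturb]

/-- `perturb` as a sum of functions: `g + ∑ᵢ pᵢ • wᵢ`. [folklore] -/
theorem perturb_eq {ι : Type*} [Fintype ι] (g : ℝ × 𝔼² → ℝ) (w : ι → ℝ × 𝔼² → ℝ) (p : ι → ℝ) :
    perturb g w p = g + ∑ i, p i • w i := by
  funext z
  simp [perturb, Finset.sum_apply, smul_eq_mul]

/-! ### Smoothness -/

section Smooth

variable {f : ℝ × 𝔼² → ℝ}

/-- The first partials of a `C^∞` function are `C^∞`. [folklore] -/
theorem contDiff_d1 (hf : ContDiff ℝ ∞ f) (i : Fin 2) : ContDiff ℝ ∞ fun z => d1 f z i := by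
  unfold d1
  exact (hf.fderiv_right (m := ∞) (by simp)).clm_apply contDiff_const

/-- The second partials of a `C^∞` function are `C^∞`. [folklore] -/
theorem contDiff_d2 (hf : ContDiff ℝ ∞ f) (i j : Fin 2) : ContDiff ℝ ∞ fun z => d2 f z i j := by
  unfold d2
  have h1 : ContDiff ℝ ∞ (fderiv ℝ f) := hf.fderiv_right (m := ∞) (by simp)
  have h2 : ContDiff ℝ ∞ (fderiv ℝ (fderiv ℝ f)) := h1.fderiv_right (m := ∞) (by simp)
  exact (h2.clm_apply contDiff_const).clm_apply contDiff_const

/-- The `λ`-derivative of a `C^∞` function is `C^∞`. [folklore] -/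
theorem contDiff_dt (hf : ContDiff ℝ ∞ f) : ContDiff ℝ ∞ fun z => dt f z := by
  unfold dt
  exact (hf.fderiv_right (m := ∞) (by simp)).clm_apply contDiff_const

/-- `δ` of a `C^∞` function is `C^∞`. [folklore] -/
theorem contDiff_hessDet (hf : ContDiff ℝ ∞ f) : ContDiff ℝ ∞ fun z => hessDet f z := by
  unfold hessDet
  exact ((contDiff_d2 hf 0 0).mul (contDiff_d2 hf 1 1)).sub ((contDiff_d2 hf 0 1).pow 2)

/-- `(r, s, t)` of a `C^∞` function is `C^∞`. [folklore] -/
theorem contDiff_jet2 (hf : ContDiff ℝ ∞ f) : ContDiff ℝ ∞ fun z => jet2 f z := by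
  refine contDiff_pi.2 fun k => ?_
  fin_cases k
  · simpa using contDiff_d2 hf 0 0
  · simpa using contDiff_d2 hf 0 1
  · simpa using contDiff_d2 hf 1 1

/-- The polynomial `Δ` is `C^∞`. [folklore] -/
theorem contDiff_delta : ContDiff ℝ ∞ delta := by
  unfold delta
  exact ((contDiff_apply ℝ ℝ 0).mul (contDiff_apply ℝ ℝ 2)).sub ((contDiff_apply ℝ ℝ 1).pow 2)

/-! ### The derivative of `Δ(r, s, t) = rt - s²` -/

/-- The derivative of `Δ` at `h = (r, s, t)`: `(ṙ, ṡ, ṫ) ↦ t ṙ - 2 s ṡ + r ṫ`. [folklore] -/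
def deltaDeriv (h : Fin 3 → ℝ) : (Fin 3 → ℝ) →L[ℝ] ℝ :=
  h 2 • (ContinuousLinearMap.proj 0 : (Fin 3 → ℝ) →L[ℝ] ℝ) +
    h 0 • (ContinuousLinearMap.proj 2 : (Fin 3 → ℝ) →L[ℝ] ℝ) -
    (2 * h 1) • (ContinuousLinearMap.proj 1 : (Fin 3 → ℝ) →L[ℝ] ℝ)

/-- Unfolding of `deltaDeriv`. [folklore] -/
theorem deltaDeriv_apply (h k : Fin 3 → ℝ) :
    deltaDeriv h k = h 2 * k 0 + h 0 * k 2 - 2 * h 1 * k 1 := by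
  simp [deltaDeriv, smul_eq_mul]

/-- `Δ` has derivative `deltaDeriv h` at `h`. [folklore] -/
theorem hasFDerivAt_delta (h : Fin 3 → ℝ) : HasFDerivAt delta (deltaDeriv h) h := by
  have h0 : HasFDerivAt (fun k : Fin 3 → ℝ => k 0) (ContinuousLinearMap.proj 0) h :=
    (ContinuousLinearMap.proj (R := ℝ) (φ := fun _ : Fin 3 => ℝ) 0).hasFDerivAt
  have h1 : HasFDerivAt (fun k : Fin 3 → ℝ => k 1) (ContinuousLinearMap.proj 1) h :=
    (ContinuousLinearMap.proj (R := ℝ) (φ := fun _ : Fin 3 => ℝ) 1).hasFDerivAt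
  have h2 : HasFDerivAt (fun k : Fin 3 → ℝ => k 2) (ContinuousLinearMap.proj 2) h :=
    (ContinuousLinearMap.proj (R := ℝ) (φ := fun _ : Fin 3 => ℝ) 2).hasFDerivAt
  have hsub : HasFDerivAt delta
      (h 0 • (ContinuousLinearMap.proj 2 : (Fin 3 → ℝ) →L[ℝ] ℝ) +
        h 2 • (ContinuousLinearMap.proj 0 : (Fin 3 → ℝ) →L[ℝ] ℝ) -
        (2 • h 1 ^ (2 - 1)) • (ContinuousLinearMap.proj 1 : (Fin 3 → ℝ) →L[ℝ] ℝ)) h :=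
    (h0.mul h2).sub (h1.pow 2)
  refine hsub.congr_fderiv ?_
  ext k
  rw [deltaDeriv_apply]
  simp
  ring

/-- At `h ≠ 0` the derivative of `Δ` is onto `ℝ`. [cite: CerfDiffeoSphere1968, Ch. II §2, "ψ est de rang 3"] -/
theorem surjective_deltaDeriv {h : Fin 3 → ℝ} (hh : h ≠ 0) : Surjective (deltaDeriv h) := by
  -- a direction on which the functional does not vanish
  have hex : ∃ k : Fin 3 → ℝ, deltaDeriv h k ≠ 0 := by
    by_contra hcon
    push Not at hcon
    apply hh
    have e0 := hcon (Pi.single 0 1)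
    have e1 := hcon (Pi.single 1 1)
    have e2 := hcon (Pi.single 2 1)
    simp [deltaDeriv_apply] at e0 e1 e2
    funext k
    fin_cases k <;> simp [e0, e1, e2]
  obtain ⟨k, hk⟩ := hex
  intro c
  refine ⟨(c / deltaDeriv h k) • k, ?_⟩
  rw [map_smul, smul_eq_mul, div_mul_cancel₀ c hk]


/-- The vector of first partials is `C^∞`. [folklore] -/
theorem contDiff_d1_pi (hf : ContDiff ℝ ∞ f) : ContDiff ℝ ∞ fun z => d1 f z :=
  contDiff_pi.2 fun i => contDiff_d1 hf i

/-- The matrix of second partials is `C^∞`. [folklore] -/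
theorem contDiff_d2_pi (hf : ContDiff ℝ ∞ f) : ContDiff ℝ ∞ fun z => d2 f z :=
  contDiff_pi.2 fun i => contDiff_pi.2 fun j => contDiff_d2 hf i j

end Smooth

/-! ### Symmetry of the second partials and Cerf's `δ = rt - s²` -/

/-- The second partials of a `C²` function are symmetric: `s = ∂²f/∂x∂y = ∂²f/∂y∂x`.
[folklore] -/
theorem d2_symm {f : ℝ × 𝔼² → ℝ} {z : ℝ × 𝔼²} {n : WithTop ℕ∞} (hf : ContDiffAt ℝ n f z)
    (hn : 2 ≤ n) (i j : Fin 2) : d2 f z i j = d2 f z j i := by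
  unfold d2
  exact hf.isSymmSndFDerivAt (by simpa using hn) (dir i) (dir j)

/-- For a `C²` function Cerf's `δ = rt - s²` is the determinant `r t - s s'` of the matrix of
second partials. [cite: CerfDiffeoSphere1968, Ch. II §2, "rt - s² = δ"] -/
theorem hessDet_eq_det {f : ℝ × 𝔼² → ℝ} {z : ℝ × 𝔼²} {n : WithTop ℕ∞} (hf : ContDiffAt ℝ n f z)
    (hn : 2 ≤ n) : hessDet f z = d2 f z 0 0 * d2 f z 1 1 - d2 f z 0 1 * d2 f z 1 0 := by
  rw [hessDet, d2_symm hf hn 1 0, sq]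

/-- The matrix of second partials vanishes iff `(r, s, t) = 0` (for a `C²` function).
[folklore] -/
theorem d2_eq_zero_iff_jet2_eq_zero {f : ℝ × 𝔼² → ℝ} {z : ℝ × 𝔼²} {n : WithTop ℕ∞}
    (hf : ContDiffAt ℝ n f z) (hn : 2 ≤ n) : d2 f z = 0 ↔ jet2 f z = 0 := by
  constructor
  · intro h
    funext k
    fin_cases k <;> simp [jet2, h]
  · intro h
    have h0 : d2 f z 0 0 = 0 := by simpa using congrFun h 0
    have h1 : d2 f z 0 1 = 0 := by simpa using congrFun h 1
    have h2 : d2 f z 1 1 = 0 := by simpa using congrFun h 2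
    have h10 : d2 f z 1 0 = 0 := by rw [d2_symm hf hn 1 0]; exact h1
    funext i j
    fin_cases i <;> fin_cases j <;> simp [h0, h1, h2, h10]

/-! ### Linearity in the perturbation parameter -/

section Linear

variable {ι : Type*} [Fintype ι] {g : ℝ × 𝔼² → ℝ} {w : ι → ℝ × 𝔼² → ℝ}

/-- The derivative of the perturbed path: `D(g + ∑ pᵢ wᵢ) = Dg + ∑ pᵢ Dwᵢ`. [folklore] -/
theorem hasFDerivAt_perturb (hg : Differentiable ℝ g) (hw : ∀ i, Differentiable ℝ (w i))
    (p : ι → ℝ) (z : ℝ × 𝔼²) :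
    HasFDerivAt (perturb g w p) (fderiv ℝ g z + ∑ i, p i • fderiv ℝ (w i) z) z := by
  unfold perturb
  exact (hg z).hasFDerivAt.add
    (HasFDerivAt.fun_sum fun i _ => ((hw i) z).hasFDerivAt.const_mul (p i))

/-- The derivative of the perturbed path, as a function. [folklore] -/
theorem fderiv_perturb (hg : Differentiable ℝ g) (hw : ∀ i, Differentiable ℝ (w i))
    (p : ι → ℝ) :
    fderiv ℝ (perturb g w p) = fun z => fderiv ℝ g z + ∑ i, p i • fderiv ℝ (w i) z := by
  funext z
  exact (hasFDerivAt_perturb hg hw p z).fderiv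

/-- **Linearity of `p, q` in the parameter**: `d1 (g + ∑ pᵢ wᵢ) = d1 g + ∑ pᵢ d1 wᵢ`.
[folklore] -/
theorem d1_perturb (hg : Differentiable ℝ g) (hw : ∀ i, Differentiable ℝ (w i))
    (p : ι → ℝ) (z : ℝ × 𝔼²) (j : Fin 2) :
    d1 (perturb g w p) z j = d1 g z j + ∑ i, p i * d1 (w i) z j := by
  simp [d1, fderiv_perturb hg hw p]

/-- **Linearity of `μ` in the parameter**: `dt (g + ∑ pᵢ wᵢ) = dt g + ∑ pᵢ dt wᵢ`. [folklore] -/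
theorem dt_perturb (hg : Differentiable ℝ g) (hw : ∀ i, Differentiable ℝ (w i))
    (p : ι → ℝ) (z : ℝ × 𝔼²) :
    dt (perturb g w p) z = dt g z + ∑ i, p i * dt (w i) z := by
  simp [dt, fderiv_perturb hg hw p]

/-- `n ≤ ∞` in the exponent order, for a natural number `n`. [folklore] -/
theorem natCast_le_infty (n : ℕ) : (n : WithTop ℕ∞) ≤ ∞ := by exact_mod_cast le_top

/-- `2 ≤ ∞` in the exponent order. [folklore] -/
theorem two_le_infty : (2 : WithTop ℕ∞) ≤ ∞ := natCast_le_infty 2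

/-- The second derivative of the perturbed path: `D²(g + ∑ pᵢ wᵢ) = D²g + ∑ pᵢ D²wᵢ` (for `C²`
data). [folklore] -/
theorem fderiv_fderiv_perturb (hg : ContDiff ℝ 2 g) (hw : ∀ i, ContDiff ℝ 2 (w i))
    (p : ι → ℝ) (z : ℝ × 𝔼²) :
    fderiv ℝ (fderiv ℝ (perturb g w p)) z =
      fderiv ℝ (fderiv ℝ g) z + ∑ i, p i • fderiv ℝ (fderiv ℝ (w i)) z := by
  have hg1 : Differentiable ℝ g := hg.differentiable two_ne_zero
  have hw1 : ∀ i, Differentiable ℝ (w i) := fun i => (hw i).differentiable two_ne_zero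
  have hg2 : Differentiable ℝ (fderiv ℝ g) :=
    (hg.fderiv_right (m := 1) (by norm_num)).differentiable one_ne_zero
  have hw2 : ∀ i, Differentiable ℝ (fderiv ℝ (w i)) := fun i =>
    ((hw i).fderiv_right (m := 1) (by norm_num)).differentiable one_ne_zero
  rw [fderiv_perturb hg1 hw1 p]
  have h : HasFDerivAt (fun z => fderiv ℝ g z + ∑ i, p i • fderiv ℝ (w i) z)
      (fderiv ℝ (fderiv ℝ g) z + ∑ i, p i • fderiv ℝ (fderiv ℝ (w i)) z) z :=
    (hg2 z).hasFDerivAt.add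
      (HasFDerivAt.fun_sum fun i _ => ((hw2 i) z).hasFDerivAt.fun_const_smul (p i))
  exact h.fderiv

/-- **Linearity of `r, s, t` in the parameter**: `d2 (g + ∑ pᵢ wᵢ) = d2 g + ∑ pᵢ d2 wᵢ` (for
`C²` data). [folklore] -/
theorem d2_perturb (hg : ContDiff ℝ 2 g) (hw : ∀ i, ContDiff ℝ 2 (w i))
    (p : ι → ℝ) (z : ℝ × 𝔼²) (j k : Fin 2) :
    d2 (perturb g w p) z j k = d2 g z j k + ∑ i, p i * d2 (w i) z j k := by
  simp [d2, fderiv_fderiv_perturb hg hw p z]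

/-- The perturbed path is `C^∞` when the data are. [folklore] -/
theorem contDiff_perturb (hg : ContDiff ℝ ∞ g) (hw : ∀ i, ContDiff ℝ ∞ (w i)) (p : ι → ℝ) :
    ContDiff ℝ ∞ (perturb g w p) := by
  unfold perturb
  exact hg.add (ContDiff.sum fun i _ => contDiff_const.mul (hw i))

/-- The perturbed family is jointly `C^∞` in `(p, z)`. [folklore] -/
theorem contDiff_perturb_uncurry (hg : ContDiff ℝ ∞ g) (hw : ∀ i, ContDiff ℝ ∞ (w i)) :
    ContDiff ℝ ∞ fun pz : (ι → ℝ) × (ℝ × 𝔼²) => perturb g w pz.1 pz.2 := by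
  unfold perturb
  refine (hg.comp contDiff_snd).add (ContDiff.sum fun i _ => ?_)
  exact ((contDiff_apply ℝ ℝ i).comp contDiff_fst).mul ((hw i).comp contDiff_snd)

/-- `p, q` of the perturbed family are jointly `C^∞` in `(p, z)`. [folklore] -/
theorem contDiff_d1_perturb_uncurry (hg : ContDiff ℝ ∞ g) (hw : ∀ i, ContDiff ℝ ∞ (w i))
    (j : Fin 2) :
    ContDiff ℝ ∞ fun pz : (ι → ℝ) × (ℝ × 𝔼²) => d1 (perturb g w pz.1) pz.2 j := by
  have hg1 : Differentiable ℝ g := hg.differentiable (by simp)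
  have hw1 : ∀ i, Differentiable ℝ (w i) := fun i => (hw i).differentiable (by simp)
  have heq : (fun pz : (ι → ℝ) × (ℝ × 𝔼²) => d1 (perturb g w pz.1) pz.2 j) =
      fun pz => d1 g pz.2 j + ∑ i, pz.1 i * d1 (w i) pz.2 j := by
    funext pz; exact d1_perturb hg1 hw1 pz.1 pz.2 j
  rw [heq]
  refine ((contDiff_d1 hg j).comp contDiff_snd).add (ContDiff.sum fun i _ => ?_)
  exact ((contDiff_apply ℝ ℝ i).comp contDiff_fst).mul ((contDiff_d1 (hw i) j).comp contDiff_snd)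

/-- `r, s, t` of the perturbed family are jointly `C^∞` in `(p, z)`. [folklore] -/
theorem contDiff_d2_perturb_uncurry (hg : ContDiff ℝ ∞ g) (hw : ∀ i, ContDiff ℝ ∞ (w i))
    (j k : Fin 2) :
    ContDiff ℝ ∞ fun pz : (ι → ℝ) × (ℝ × 𝔼²) => d2 (perturb g w pz.1) pz.2 j k := by
  have hg2 : ContDiff ℝ 2 g := hg.of_le two_le_infty
  have hw2 : ∀ i, ContDiff ℝ 2 (w i) := fun i => (hw i).of_le two_le_infty
  have heq : (fun pz : (ι → ℝ) × (ℝ × 𝔼²) => d2 (perturb g w pz.1) pz.2 j k) =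
      fun pz => d2 g pz.2 j k + ∑ i, pz.1 i * d2 (w i) pz.2 j k := by
    funext pz; exact d2_perturb hg2 hw2 pz.1 pz.2 j k
  rw [heq]
  refine ((contDiff_d2 hg j k).comp contDiff_snd).add (ContDiff.sum fun i _ => ?_)
  exact ((contDiff_apply ℝ ℝ i).comp contDiff_fst).mul ((contDiff_d2 (hw i) j k).comp contDiff_snd)

/-- `μ` of the perturbed family is jointly `C^∞` in `(p, z)`. [folklore] -/
theorem contDiff_dt_perturb_uncurry (hg : ContDiff ℝ ∞ g) (hw : ∀ i, ContDiff ℝ ∞ (w i)) :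
    ContDiff ℝ ∞ fun pz : (ι → ℝ) × (ℝ × 𝔼²) => dt (perturb g w pz.1) pz.2 := by
  have hg1 : Differentiable ℝ g := hg.differentiable (by simp)
  have hw1 : ∀ i, Differentiable ℝ (w i) := fun i => (hw i).differentiable (by simp)
  have heq : (fun pz : (ι → ℝ) × (ℝ × 𝔼²) => dt (perturb g w pz.1) pz.2) =
      fun pz => dt g pz.2 + ∑ i, pz.1 i * dt (w i) pz.2 := by
    funext pz; exact dt_perturb hg1 hw1 pz.1 pz.2
  rw [heq]
  refine ((contDiff_dt hg).comp contDiff_snd).add (ContDiff.sum fun i _ => ?_)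
  exact ((contDiff_apply ℝ ℝ i).comp contDiff_fst).mul ((contDiff_dt (hw i)).comp contDiff_snd)

/-- `δ` of the perturbed family is jointly `C^∞` in `(p, z)`. [folklore] -/
theorem contDiff_hessDet_perturb_uncurry (hg : ContDiff ℝ ∞ g) (hw : ∀ i, ContDiff ℝ ∞ (w i)) :
    ContDiff ℝ ∞ fun pz : (ι → ℝ) × (ℝ × 𝔼²) => hessDet (perturb g w pz.1) pz.2 := by
  unfold hessDet
  exact ((contDiff_d2_perturb_uncurry hg hw 0 0).mul (contDiff_d2_perturb_uncurry hg hw 1 1)).sub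
    ((contDiff_d2_perturb_uncurry hg hw 0 1).pow 2)

/-- `(r, s, t)` of the perturbed family is jointly `C^∞` in `(p, z)`. [folklore] -/
theorem contDiff_jet2_perturb_uncurry (hg : ContDiff ℝ ∞ g) (hw : ∀ i, ContDiff ℝ ∞ (w i)) :
    ContDiff ℝ ∞ fun pz : (ι → ℝ) × (ℝ × 𝔼²) => jet2 (perturb g w pz.1) pz.2 := by
  refine contDiff_pi.2 fun k => ?_
  fin_cases k
  · simpa using contDiff_d2_perturb_uncurry hg hw 0 0
  · simpa using contDiff_d2_perturb_uncurry hg hw 0 1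
  · simpa using contDiff_d2_perturb_uncurry hg hw 1 1

/-- `p, q` of the perturbed family, as a vector, jointly `C^∞` in `(p, z)`. [folklore] -/
theorem contDiff_d1_pi_perturb_uncurry (hg : ContDiff ℝ ∞ g) (hw : ∀ i, ContDiff ℝ ∞ (w i)) :
    ContDiff ℝ ∞ fun pz : (ι → ℝ) × (ℝ × 𝔼²) => d1 (perturb g w pz.1) pz.2 :=
  contDiff_pi.2 fun j => contDiff_d1_perturb_uncurry hg hw j

/-- `(r, s, t)` of the perturbed family in terms of those of the data. [folklore] -/
theorem jet2_perturb (hg : ContDiff ℝ 2 g) (hw : ∀ i, ContDiff ℝ 2 (w i))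
    (p : ι → ℝ) (z : ℝ × 𝔼²) :
    jet2 (perturb g w p) z = jet2 g z + ∑ i, p i • jet2 (w i) z := by
  funext k
  fin_cases k <;> simp [jet2, d2_perturb hg hw p z, Finset.sum_apply]

end Linear

/-! ### Dictionary with the slices `f_λ = f (λ, ·)` -/

section Slice

/-- The slice `x ↦ F (λ, x)` of a map on `ℝ × ℝ²` has derivative `DF(λ, x) ∘ inr`. [folklore] -/
theorem hasFDerivAt_slice {G : Type*} [NormedAddCommGroup G] [NormedSpace ℝ G]
    {F : ℝ × 𝔼² → G} {z : ℝ × 𝔼²} {A : ℝ × 𝔼² →L[ℝ] G} (hF : HasFDerivAt F A z) :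
    HasFDerivAt (fun x => F (z.1, x)) (A ∘L ContinuousLinearMap.inr ℝ ℝ 𝔼²) z.2 := by
  have h1 : HasFDerivAt (fun x : 𝔼² => (z.1, x)) (ContinuousLinearMap.inr ℝ ℝ 𝔼²) z.2 :=
    (hasFDerivAt_const z.1 z.2).prodMk (hasFDerivAt_id z.2)
  have h2 : HasFDerivAt F A ((fun x : 𝔼² => (z.1, x)) z.2) := by simpa using hF
  exact h2.comp z.2 h1

variable {f : ℝ × 𝔼² → ℝ}

/-- **`p, q` are the partials of the slice**: `D(f_λ)(x) eᵢ = d1 f (λ, x) i`.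
[cite: CerfDiffeoSphere1968, Ch. II §2, (6)] -/
theorem fderiv_slice_apply_single {z : ℝ × 𝔼²} (hf : DifferentiableAt ℝ f z) (i : Fin 2) :
    fderiv ℝ (fun x => f (z.1, x)) z.2 (EuclideanSpace.single i 1) = d1 f z i := by
  rw [(hasFDerivAt_slice hf.hasFDerivAt).fderiv, d1, dir]
  simp

/-- The derivative of the slice as a composition, at every point (for differentiable `f`).
[folklore] -/
theorem fderiv_slice_eq (hf : Differentiable ℝ f) (t : ℝ) :
    fderiv ℝ (fun x => f (t, x)) = fun x => fderiv ℝ f (t, x) ∘L ContinuousLinearMap.inr ℝ ℝ 𝔼² := by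
  funext x
  exact (hasFDerivAt_slice (z := (t, x)) (hf (t, x)).hasFDerivAt).fderiv

/-- **`r, s, t` are the second partials of the slice**:
`D²(f_λ)(x) eᵢ eⱼ = d2 f (λ, x) i j` (for `C²` data). [cite: CerfDiffeoSphere1968, Ch. II §2, (6)] -/
theorem fderiv_fderiv_slice_apply_single {n : WithTop ℕ∞} (hf : ContDiff ℝ n f) (hn : 2 ≤ n)
    (z : ℝ × 𝔼²) (i j : Fin 2) :
    fderiv ℝ (fderiv ℝ (fun x => f (z.1, x))) z.2 (EuclideanSpace.single i 1)
      (EuclideanSpace.single j 1) = d2 f z i j := by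
  have hn0 : n ≠ 0 := by
    rintro rfl
    exact absurd hn (by norm_num)
  have hf1 : Differentiable ℝ f := hf.differentiable hn0
  have hf2 : Differentiable ℝ (fderiv ℝ f) := by
    have := hf.fderiv_right (m := 1) (by
      calc (1 : WithTop ℕ∞) + 1 = 2 := by norm_num
        _ ≤ n := hn)
    exact this.differentiable one_ne_zero
  rw [fderiv_slice_eq hf1 z.1]
  -- the function `x ↦ Df(λ, x) ∘ inr` is the slice of `z ↦ Df z ∘ inr`
  set F : ℝ × 𝔼² → (𝔼² →L[ℝ] ℝ) := fun z => fderiv ℝ f z ∘L ContinuousLinearMap.inr ℝ ℝ 𝔼²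
    with hF
  have hFd : ∀ z, HasFDerivAt F
      (((ContinuousLinearMap.compL ℝ 𝔼² (ℝ × 𝔼²) ℝ).flip (ContinuousLinearMap.inr ℝ ℝ 𝔼²)) ∘L
        fderiv ℝ (fderiv ℝ f) z) z := by
    intro z
    have h := ((hf2 z).hasFDerivAt).clm_comp (hasFDerivAt_const (ContinuousLinearMap.inr ℝ ℝ 𝔼²) z)
    simpa using h
  have hslice := hasFDerivAt_slice (z := z) (hFd z)
  have : (fun x => F (z.1, x)) = fun x => fderiv ℝ f (z.1, x) ∘L ContinuousLinearMap.inr ℝ ℝ 𝔼² := rfl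
  rw [← this, hslice.fderiv]
  simp [d2, dir, ContinuousLinearMap.compL_apply, ContinuousLinearMap.flip_apply]

/-- The value of the slice: trivial but useful for rewriting. [folklore] -/
theorem slice_apply (t : ℝ) (x : 𝔼²) : (fun x => f (t, x)) x = f (t, x) := rfl

end Slice

/-! ### Vanishing of the first partials and the derivative of the slice -/

/-- On the plane a continuous linear functional vanishes iff it vanishes on `e₀, e₁`.
[folklore] -/
theorem clm_eq_zero_iff_apply_single (L : EuclideanSpace ℝ (Fin 2) →L[ℝ] ℝ) :
    L = 0 ↔ ∀ i : Fin 2, L (EuclideanSpace.single i 1) = 0 := by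
  constructor
  · intro h i; simp [h]
  · intro h
    apply ContinuousLinearMap.coe_injective
    refine (EuclideanSpace.basisFun (Fin 2) ℝ).toBasis.ext fun i => ?_
    simp [h i]

/-- **Critical points of the slice in Cerf's coordinates**: `(x, y)` is a critical point of
`f_λ` iff `p = q = 0`, i.e. `d1 f (λ, (x, y)) = 0`. [cite: CerfDiffeoSphere1968, Ch. II §2, (8)] -/
theorem fderiv_slice_eq_zero_iff {f : ℝ × 𝔼² → ℝ} {z : ℝ × 𝔼²} (hf : DifferentiableAt ℝ f z) :
    fderiv ℝ (fun x => f (z.1, x)) z.2 = 0 ↔ d1 f z = 0 := by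
  rw [clm_eq_zero_iff_apply_single]
  simp only [fderiv_slice_apply_single hf, funext_iff, Pi.zero_apply]

/-! ### Parameter derivatives: the linear maps `ṗ ↦ ∑ᵢ ṗᵢ cᵢ` -/

section Lin

variable {V : Type*} [NormedAddCommGroup V] [NormedSpace ℝ V] {ι : Type*} [Fintype ι]

/-- The continuous linear map `ṗ ↦ ∑ᵢ ṗᵢ cᵢ : ℝᵐ → V`. [folklore] -/
def lin (c : ι → V) : (ι → ℝ) →L[ℝ] V :=
  ∑ i, (ContinuousLinearMap.proj i : (ι → ℝ) →L[ℝ] ℝ).smulRight (c i)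

/-- `lin c q = ∑ qᵢ cᵢ`. [folklore] -/
@[simp]
theorem lin_apply (c : ι → V) (q : ι → ℝ) : lin c q = ∑ i, q i • c i := by
  simp [lin, ContinuousLinearMap.smulRight_apply]

/-- `z ↦ lin (c z)` is `C^∞` when the coefficients are. [folklore] -/
theorem contDiff_lin {X : Type*} [NormedAddCommGroup X] [NormedSpace ℝ X] {c : ι → X → V}
    (hc : ∀ i, ContDiff ℝ ∞ (c i)) : ContDiff ℝ ∞ fun z => lin fun i => c i z := by
  unfold lin
  refine ContDiff.sum fun i _ => ?_
  exact (ContinuousLinearMap.smulRightL ℝ (ι → ℝ) V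
    (ContinuousLinearMap.proj i : (ι → ℝ) →L[ℝ] ℝ)).contDiff.comp (hc i)

/-- The affine map `p ↦ a + ∑ᵢ pᵢ cᵢ` has derivative `lin c`. [folklore] -/
theorem hasFDerivAt_const_add_sum_smul (a : V) (c : ι → V) (p : ι → ℝ) :
    HasFDerivAt (fun q : ι → ℝ => a + ∑ i, q i • c i) (lin c) p := by
  have h : (fun q : ι → ℝ => a + ∑ i, q i • c i) = fun q => a + lin c q := by
    funext q; rw [lin_apply]
  rw [h]
  exact ((lin c).hasFDerivAt).const_add a

end Lin

section ParamDeriv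

variable {ι : Type*} [Fintype ι]

/-- The parameter derivative of the VALUE of the perturbed family: `ṗ ↦ ∑ᵢ ṗᵢ wᵢ(z)`.
[folklore] -/
def D0 (w : ι → ℝ × 𝔼² → ℝ) (z : ℝ × 𝔼²) : (ι → ℝ) →L[ℝ] ℝ :=
  lin fun i => w i z

/-- The parameter derivative of `(p, q)` of the perturbed family: `ṗ ↦ ∑ᵢ ṗᵢ d1 wᵢ z`.
[folklore] -/
def D1 (w : ι → ℝ × 𝔼² → ℝ) (z : ℝ × 𝔼²) : (ι → ℝ) →L[ℝ] (Fin 2 → ℝ) :=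
  lin fun i => d1 (w i) z

/-- The parameter derivative of `(r, s, t)` of the perturbed family: `ṗ ↦ ∑ᵢ ṗᵢ jet2 wᵢ z`.
[folklore] -/
def D2 (w : ι → ℝ × 𝔼² → ℝ) (z : ℝ × 𝔼²) : (ι → ℝ) →L[ℝ] (Fin 3 → ℝ) :=
  lin fun i => jet2 (w i) z

/-- The full 2-jet parameter derivative at `z`: `ṗ ↦ (∑ ṗᵢ wᵢ z, ∑ ṗᵢ d1 wᵢ z, ∑ ṗᵢ jet2 wᵢ z)`.
Its surjectivity says that the perturbation directions `wᵢ` realise every 2-jet at `z` — the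
finite-dimensional form of the hypothesis of Thom's transversality theorem in Cerf's Ch. II §1.
[cite: CerfDiffeoSphere1968, Ch. II §1] -/
def D012 (w : ι → ℝ × 𝔼² → ℝ) (z : ℝ × 𝔼²) :
    (ι → ℝ) →L[ℝ] ℝ × (Fin 2 → ℝ) × (Fin 3 → ℝ) :=
  (D0 w z).prod ((D1 w z).prod (D2 w z))

variable {w : ι → ℝ × 𝔼² → ℝ}

/-- Unfolding of `D0`. [folklore] -/
theorem D0_apply (w : ι → ℝ × 𝔼² → ℝ) (z : ℝ × 𝔼²) (q : ι → ℝ) :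
    D0 w z q = ∑ i, q i * w i z := by simp [D0]

/-- Unfolding of `D1`. [folklore] -/
theorem D1_apply (w : ι → ℝ × 𝔼² → ℝ) (z : ℝ × 𝔼²) (q : ι → ℝ) :
    D1 w z q = ∑ i, q i • d1 (w i) z := by simp [D1]

/-- Unfolding of `D2`. [folklore] -/
theorem D2_apply (w : ι → ℝ × 𝔼² → ℝ) (z : ℝ × 𝔼²) (q : ι → ℝ) :
    D2 w z q = ∑ i, q i • jet2 (w i) z := by simp [D2]

/-- Unfolding of `D012`. [folklore] -/
theorem D012_apply (w : ι → ℝ × 𝔼² → ℝ) (z : ℝ × 𝔼²) (q : ι → ℝ) :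
    D012 w z q = (D0 w z q, D1 w z q, D2 w z q) := rfl

/-- **The value of the perturbed family is affine in the parameter**, with derivative `D0 w z`.
[folklore] -/
theorem hasFDerivAt_perturb_param (g : ℝ × 𝔼² → ℝ) (w : ι → ℝ × 𝔼² → ℝ) (z : ℝ × 𝔼²)
    (p : ι → ℝ) : HasFDerivAt (fun q => perturb g w q z) (D0 w z) p := by
  have h := hasFDerivAt_const_add_sum_smul (g z) (fun i => w i z) p
  simpa [perturb, D0, smul_eq_mul] using h

/-- **`(p, q)` of the perturbed family is affine in the parameter**, with derivative `D1 w z`.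
[folklore] -/
theorem hasFDerivAt_d1_perturb_param {g : ℝ × 𝔼² → ℝ} (hg : Differentiable ℝ g)
    (hw : ∀ i, Differentiable ℝ (w i)) (z : ℝ × 𝔼²) (p : ι → ℝ) :
    HasFDerivAt (fun q => d1 (perturb g w q) z) (D1 w z) p := by
  have h := hasFDerivAt_const_add_sum_smul (d1 g z) (fun i => d1 (w i) z) p
  have heq : (fun q : ι → ℝ => d1 (perturb g w q) z) = fun q => d1 g z + ∑ i, q i • d1 (w i) z := by
    funext q; funext j
    simp [d1_perturb hg hw q z j, Finset.sum_apply, smul_eq_mul]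
  rw [heq]; exact h

/-- **`(r, s, t)` of the perturbed family is affine in the parameter**, with derivative `D2 w z`
(for `C²` data). [folklore] -/
theorem hasFDerivAt_jet2_perturb_param {g : ℝ × 𝔼² → ℝ} (hg : ContDiff ℝ 2 g)
    (hw : ∀ i, ContDiff ℝ 2 (w i)) (z : ℝ × 𝔼²) (p : ι → ℝ) :
    HasFDerivAt (fun q => jet2 (perturb g w q) z) (D2 w z) p := by
  have h := hasFDerivAt_const_add_sum_smul (jet2 g z) (fun i => jet2 (w i) z) p
  have heq : (fun q : ι → ℝ => jet2 (perturb g w q) z) = fun q => jet2 g z + ∑ i, q i • jet2 (w i) z := by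
    funext q; exact jet2_perturb hg hw q z
  rw [heq]; exact h

/-- **The full 2-jet of the perturbed family is affine in the parameter**, with derivative
`D012 w z`. [folklore] -/
theorem hasFDerivAt_jet012_perturb_param {g : ℝ × 𝔼² → ℝ} (hg : ContDiff ℝ 2 g)
    (hw : ∀ i, ContDiff ℝ 2 (w i)) (z : ℝ × 𝔼²) (p : ι → ℝ) :
    HasFDerivAt (fun q => (perturb g w q z, d1 (perturb g w q) z, jet2 (perturb g w q) z))
      (D012 w z) p := by
  have hg1 : Differentiable ℝ g := hg.differentiable two_ne_zero
  have hw1 : ∀ i, Differentiable ℝ (w i) := fun i => (hw i).differentiable two_ne_zero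
  exact (hasFDerivAt_perturb_param g w z p).prodMk
    ((hasFDerivAt_d1_perturb_param hg1 hw1 z p).prodMk (hasFDerivAt_jet2_perturb_param hg hw z p))

/-- The coefficient maps are `C^∞` in `z` when the `wᵢ` are. [folklore] -/
theorem contDiff_D0 (hw : ∀ i, ContDiff ℝ ∞ (w i)) : ContDiff ℝ ∞ fun z => D0 w z :=
  contDiff_lin (c := fun i z => w i z) hw

/-- `z ↦ D1 w z` is `C^∞`. [folklore] -/
theorem contDiff_D1 (hw : ∀ i, ContDiff ℝ ∞ (w i)) : ContDiff ℝ ∞ fun z => D1 w z :=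
  contDiff_lin (c := fun i z => d1 (w i) z) fun i => contDiff_d1_pi (hw i)

/-- `z ↦ D2 w z` is `C^∞`. [folklore] -/
theorem contDiff_D2 (hw : ∀ i, ContDiff ℝ ∞ (w i)) : ContDiff ℝ ∞ fun z => D2 w z :=
  contDiff_lin (c := fun i z => jet2 (w i) z) fun i => contDiff_jet2 (hw i)

end ParamDeriv

end CerfPath

end Literature.Topology.FourManifolds
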